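import Summits.CriticalPhenomena.PercolationContinuityZ3.Theses.PercNearOneGluing
import Summits.CriticalPhenomena.PercolationContinuityZ3.Theorems.PercNearOneGluingAdditiveGluingStarGlueRelay
import Summits.CriticalPhenomena.PercolationContinuityZ3.Theorems.PercNearOneGluingAdditiveGluingGoodStepOneBond
import Literature.Probability.Percolation.KozmaNitzanPreFKG
import HarnessLib

/-! # Crux `PercNearOneGluing.AdditiveGluing` (stmt-CriticalPhenomena-4576), line `starglue` — stub `stub_starGlueSmall_sg`

Support file (`--supports stmt-CriticalPhenomena-4576`); no definitions, no named facts.  Proves exactly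
the registered stub `stub_starGlueSmall_sg` of the skeleton `Cruxes/AdditiveGluing/Lines/starglue.lean`:
the STAR step (glued star pair `e = s(o, y)`, `w₁ = w[e ↦ 1]`, `a₀` a minimiser of `P_w(· ↔ b)` on `A`,
`b ∈ A`) when the glued neighbour `y` is not a relay and there are at most two relays besides `b`
(`(A.erase b).card ≤ 2`):

  `P_{w₁}(o ↔ A) − (1 − P_{w₁}(a₀ ↔ b)) ≤ P_{w₁}(o ↔ b)`.

## Proof

Write `S = {o, y}` and, in a configuration `ω` (law `P = P_w`), `S ↔ x` for `o ↔ x ∨ y ↔ x`.  Opening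
`e` is the glue pushforward `goodStep_real_update_one`, `P_{w₁}(T) = P_w {ω | ω ∪ {e} ∈ T}`, and
`ω ∪ {e} ∈ {x ↔ z}` iff `x ↔ z` or (`x ↔ S` and `S ↔ z`) (`starGlueRelay_union_pair_mem_openConn_iff`).
Hence `P_{w₁}(o ↔ A) ≤ P(S ↔ A)`, `P_{w₁}(a₀ ↔ b) ≤ P(E₁)` with
`E₁ = {a₀ ↔ b} ∪ ({a₀ ↔ S} ∩ {S ↔ b})`, and `P(S ↔ b) ≤ P_{w₁}(o ↔ b)`.  With
`LF = {a₀ ↔ b, S ↮ b, S ↔ A}`, `T₁ = {a₀ ↮ b, S ↮ b, S ↔ A}`, `WIN = {S ↔ b, a₀ ↮ o, a₀ ↮ y}`,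
`DC = {a₀ ↮ b, S ↮ A}` one has `{S ↔ A} ⊆ {S ↔ b} ∪ LF ∪ T₁` (as `b ∈ A`) and
`WIN ⊔ DC ⊔ T₁ ⊆ E₁ᶜ`, so the claim follows from the block inequality `P(LF) ≤ P(WIN) + P(DC)`:
* if `a₀ = b`, every relay is `P`-a.s. joined to `b` (minimality: `1 = P(b ↔ b) ≤ P(a ↔ b)`), and on
  `LF` some relay reached from `S` is not joined to `b`, so `P(LF) = 0`;
* if `a₀ ≠ b`, then `A ⊆ {b, a₀, c}` for a relay `c`, and the Kozma–Nitzan Lemma 3(ii) exchange with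
  the decreasing event `N = {a₀ ↮ S}` (`KozmaNitzan2024_lemma3_ii_notConn`, minimality at `c`),
  `P(a₀ ↔ b, N) ≤ P(c ↔ b, N)`, gives it: `LF ⊔ {a₀ ↔ b, S dead} ⊆ {a₀ ↔ b} ∩ N`,
  `{c ↔ b} ∩ N ⊆ WIN ∪ {c ↔ b, S dead}` (on `{c ↔ b, a₀ ↮ S, S ↮ b}` the block `S` reaches no relay),
  and `{c ↔ b, S dead} ⊆ {a₀ ↔ b, S dead} ∪ DC`.
[cite: KozmaNitzan2024, Lemma 3(ii) (pp. 6–7), Lemma 5 (p. 13)]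
-/

namespace Summit.CriticalPhenomena.PercolationContinuityZ3.Theorems

open MeasureTheory Set Literature.Probability.LatticeModels Literature.Probability.Percolation
open scoped Classical BigOperators

noncomputable section

/-- **Bookkeeping for one exchange.**  For a finite measure: if `LF ⊔ D₁ ⊆ X₁`, `μ(X₁) ≤ μ(X₂)`,
`X₂ ⊆ WIN ∪ D₂` and `D₂ ⊆ D₁ ∪ DC`, then `μ(LF) ≤ μ(WIN) + μ(DC)`. [folklore] -/
theorem starGlueSmall_measure_chain {α : Type*} [MeasurableSpace α] (μ : Measure α)
    [IsFiniteMeasure μ] {LF D₁ X₁ X₂ WIN D₂ DC : Set α} (hD₁ : MeasurableSet D₁)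
    (h1 : LF ∪ D₁ ⊆ X₁) (hdisj : Disjoint LF D₁) (h12 : μ.real X₁ ≤ μ.real X₂)
    (h2 : X₂ ⊆ WIN ∪ D₂) (h3 : D₂ ⊆ D₁ ∪ DC) :
    μ.real LF ≤ μ.real WIN + μ.real DC := by
  have e1 : μ.real (LF ∪ D₁) = μ.real LF + μ.real D₁ := measureReal_union hdisj hD₁
  have e2 : μ.real (LF ∪ D₁) ≤ μ.real X₁ := measureReal_mono h1 (measure_ne_top _ _)
  have e3 : μ.real X₂ ≤ μ.real WIN + μ.real D₂ :=
    (measureReal_mono h2 (measure_ne_top _ _)).trans (measureReal_union_le _ _)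
  have e4 : μ.real D₂ ≤ μ.real D₁ + μ.real DC :=
    (measureReal_mono h3 (measure_ne_top _ _)).trans (measureReal_union_le _ _)
  linarith

/-- **Block inequality `LF ≤ WIN + DC` for the block `S = {o, y}` when `A ⊆ {b, a₀, c}`** and
`P(a₀ ↔ b) ≤ P(c ↔ b)`:
`P(a₀ ↔ b, S ↮ b, S ↔ A) ≤ P(S ↔ b, a₀ ↮ o, a₀ ↮ y) + P(a₀ ↮ b, S ↮ A)`, by one Kozma–Nitzan
Lemma 3(ii) exchange `P(a₀ ↔ b, a₀ ↮ S) ≤ P(c ↔ b, a₀ ↮ S)` (`KozmaNitzan2024_lemma3_ii_notConn`):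
on `{c ↔ b, a₀ ↮ S, S ↮ b}` the block `S` reaches no relay.
[cite: KozmaNitzan2024, Lemma 3(ii) (pp. 6–7)] -/
theorem starGlueSmall_block {n : ℕ} (w : Sym2 (Fin n) → unitInterval) (A : Finset (Fin n))
    (o y b a₀ c : Fin n) (ha₀ : a₀ ∈ A) (hA : ∀ a ∈ A, a = b ∨ a = a₀ ∨ a = c)
    (hmin : (prodBernoulli w).real (openConn a₀ b) ≤ (prodBernoulli w).real (openConn c b)) :
    (prodBernoulli w).real {ω : BondConfig (Fin n) | (openGraph ω).Reachable a₀ b ∧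
        ¬ ((openGraph ω).Reachable o b ∨ (openGraph ω).Reachable y b) ∧
        ∃ a ∈ A, ((openGraph ω).Reachable o a ∨ (openGraph ω).Reachable y a)} ≤
      (prodBernoulli w).real {ω : BondConfig (Fin n) |
          ((openGraph ω).Reachable o b ∨ (openGraph ω).Reachable y b) ∧
          ¬ (openGraph ω).Reachable a₀ o ∧ ¬ (openGraph ω).Reachable a₀ y} +
      (prodBernoulli w).real {ω : BondConfig (Fin n) | ¬ (openGraph ω).Reachable a₀ b ∧
          ∀ a ∈ A, ¬ ((openGraph ω).Reachable o a ∨ (openGraph ω).Reachable y a)} := by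
  -- the exchange with the decreasing event `N = {a₀ ↮ {o, y}}`
  have L3 := KozmaNitzan2024_lemma3_ii_notConn w a₀ c b ({o, y} : Set (Fin n)) hmin
  have hoS : o ∈ ({o, y} : Set (Fin n)) := Set.mem_insert o {y}
  have hyS : y ∈ ({o, y} : Set (Fin n)) := Set.mem_insert_of_mem o (Set.mem_singleton y)
  refine starGlueSmall_measure_chain (prodBernoulli w)
    (D₁ := {ω : BondConfig (Fin n) | (openGraph ω).Reachable a₀ b ∧
        ∀ a ∈ A, ¬ ((openGraph ω).Reachable o a ∨ (openGraph ω).Reachable y a)})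
    (D₂ := {ω : BondConfig (Fin n) | (openGraph ω).Reachable c b ∧
        ∀ a ∈ A, ¬ ((openGraph ω).Reachable o a ∨ (openGraph ω).Reachable y a)})
    MeasurableSet.of_discrete ?_ ?_ L3 ?_ ?_
  · -- `LF ⊔ D₁ ⊆ {a₀ ↔ b} ∩ N`
    rintro ω (⟨hab, hSb, -⟩ | ⟨hab, hdead⟩)
    · refine ⟨hab, fun u hu hau => ?_⟩
      rcases hu with hu | hu
      · rw [hu] at hau
        exact hSb (Or.inl (hau.symm.trans hab))
      · rw [Set.mem_singleton_iff.1 hu] at hau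
        exact hSb (Or.inr (hau.symm.trans hab))
    · refine ⟨hab, fun u hu hau => ?_⟩
      rcases hu with hu | hu
      · rw [hu] at hau
        exact hdead a₀ ha₀ (Or.inl hau.symm)
      · rw [Set.mem_singleton_iff.1 hu] at hau
        exact hdead a₀ ha₀ (Or.inr hau.symm)
  · -- `LF` and `D₁` are disjoint (`S ↔ A` versus `S ↮ A`)
    exact Set.disjoint_left.2 fun ω ⟨_, _, a, ha, hSa⟩ ⟨_, hdead⟩ => hdead a ha hSa
  · -- `{c ↔ b} ∩ N ⊆ WIN ∪ D₂`
    rintro ω ⟨hcb, hN⟩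
    by_cases hSb : (openGraph ω).Reachable o b ∨ (openGraph ω).Reachable y b
    · exact Or.inl ⟨hSb, hN o hoS, hN y hyS⟩
    · refine Or.inr ⟨hcb, fun a ha hSa => ?_⟩
      rcases hA a ha with h | h | h <;> rw [h] at hSa
      · exact hSb hSa
      · rcases hSa with h' | h'
        · exact hN o hoS h'.symm
        · exact hN y hyS h'.symm
      · rcases hSa with h' | h'
        · exact hSb (Or.inl (h'.trans hcb))
        · exact hSb (Or.inr (h'.trans hcb))
  · -- `D₂ ⊆ D₁ ∪ DC`
    rintro ω ⟨-, hdead⟩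
    by_cases hab : (openGraph ω).Reachable a₀ b
    · exact Or.inl ⟨hab, hdead⟩
    · exact Or.inr ⟨hab, hdead⟩

/-- **Registered stub `stub_starGlueSmall_sg`** (line `starglue`, STAR step with at most two relays
besides `b`, `y ∉ A`, `b ∈ A`): for the glued weight function `w₁ = w[s(o, y) ↦ 1]` and a minimiser
`a₀` of `P_w(· ↔ b)` on `A`, `P_{w₁}(o ↔ A) − (1 − P_{w₁}(a₀ ↔ b)) ≤ P_{w₁}(o ↔ b)`.  Reduced via the
glue pushforward to the block inequality `LF ≤ WIN + DC` for `S = {o, y}` (`starGlueSmall_block`, one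
Kozma–Nitzan Lemma 3(ii) exchange with the other relay; the case `a₀ = b` is degenerate).
[cite: KozmaNitzan2024, Lemma 3(ii) (pp. 6–7), Lemma 5 (p. 13)] -/
theorem stub_starGlueSmall_sg : ∀ (n : ℕ) (w : Sym2 (Fin n) → unitInterval) (A : Finset (Fin n)) (o y b a₀ : Fin n),
    b ∈ A → o ∉ A → y ≠ o → w s(o, y) = 0 → a₀ ∈ A →
    (∀ a ∈ A, (prodBernoulli w).real (openConn a₀ b) ≤ (prodBernoulli w).real (openConn a b)) →
    y ∉ A → (A.erase b).card ≤ 2 →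
    (prodBernoulli (Function.update w s(o, y) 1)).real (⋃ a ∈ A, openConn o a)
        - (1 - (prodBernoulli (Function.update w s(o, y) 1)).real (openConn a₀ b))
      ≤ (prodBernoulli (Function.update w s(o, y) 1)).real (openConn o b) := by
  intro n w A o y b a₀ hb _ho hyo _hw ha₀ hmin _hy hcard
  have hoy : o ≠ y := fun h => hyo h.symm
  have hoB : o ∈ ({o, y} : Finset (Fin n)) := by simp
  have hyB : y ∈ ({o, y} : Finset (Fin n)) := by simp
  -- the events of the un-glued measure `P = prodBernoulli w` (`S = {o, y}`)
  set SA : Set (BondConfig (Fin n)) := {ω | ∃ a ∈ A,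
    ((openGraph ω).Reachable o a ∨ (openGraph ω).Reachable y a)} with hSA_def
  set Sb : Set (BondConfig (Fin n)) :=
    {ω | (openGraph ω).Reachable o b ∨ (openGraph ω).Reachable y b} with hSb_def
  set E₁ : Set (BondConfig (Fin n)) := {ω | (openGraph ω).Reachable a₀ b ∨
    (((openGraph ω).Reachable a₀ o ∨ (openGraph ω).Reachable a₀ y) ∧
      ((openGraph ω).Reachable o b ∨ (openGraph ω).Reachable y b))} with hE₁_def
  set LF : Set (BondConfig (Fin n)) := {ω | (openGraph ω).Reachable a₀ b ∧
    ¬ ((openGraph ω).Reachable o b ∨ (openGraph ω).Reachable y b) ∧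
    ∃ a ∈ A, ((openGraph ω).Reachable o a ∨ (openGraph ω).Reachable y a)} with hLF_def
  set T₁ : Set (BondConfig (Fin n)) := {ω |
    (∃ a ∈ A, ((openGraph ω).Reachable o a ∨ (openGraph ω).Reachable y a)) ∧
    ¬ ((openGraph ω).Reachable o b ∨ (openGraph ω).Reachable y b) ∧
    ¬ (openGraph ω).Reachable a₀ b} with hT₁_def
  set WIN : Set (BondConfig (Fin n)) := {ω |
    ((openGraph ω).Reachable o b ∨ (openGraph ω).Reachable y b) ∧
    ¬ (openGraph ω).Reachable a₀ o ∧ ¬ (openGraph ω).Reachable a₀ y} with hWIN_def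
  set DC : Set (BondConfig (Fin n)) := {ω | ¬ (openGraph ω).Reachable a₀ b ∧
    ∀ a ∈ A, ¬ ((openGraph ω).Reachable o a ∨ (openGraph ω).Reachable y a)} with hDC_def
  -- (1) `P_{w₁}(o ↔ A) ≤ P(S ↔ A)`
  have h1 : (prodBernoulli (Function.update w s(o, y) 1)).real (⋃ a ∈ A, openConn o a) ≤
      (prodBernoulli w).real SA := by
    rw [goodStep_real_update_one w hoy]
    refine measureReal_mono ?_ (measure_ne_top _ _)
    intro ω hω
    rw [Set.mem_setOf_eq, Set.mem_iUnion₂] at hω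
    obtain ⟨a, ha, hωa⟩ := hω
    rw [starGlueRelay_union_pair_mem_openConn_iff hoy] at hωa
    refine ⟨a, ha, ?_⟩
    rcases hωa with h | ⟨-, s, hs, hsa⟩
    · exact Or.inl h
    · rw [Finset.mem_insert, Finset.mem_singleton] at hs
      rcases hs with hs | hs <;> rw [hs] at hsa
      · exact Or.inl hsa
      · exact Or.inr hsa
  -- (2) `P_{w₁}(a₀ ↔ b) ≤ P(E₁)`
  have h2 : (prodBernoulli (Function.update w s(o, y) 1)).real (openConn a₀ b) ≤
      (prodBernoulli w).real E₁ := by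
    rw [goodStep_real_update_one w hoy]
    refine measureReal_mono ?_ (measure_ne_top _ _)
    intro ω hω
    rw [Set.mem_setOf_eq, starGlueRelay_union_pair_mem_openConn_iff hoy] at hω
    rcases hω with h | ⟨⟨s, hs, hs'⟩, ⟨t, ht, ht'⟩⟩
    · exact Or.inl h
    · rw [Finset.mem_insert, Finset.mem_singleton] at hs ht
      refine Or.inr ⟨?_, ?_⟩
      · rcases hs with hs | hs <;> rw [hs] at hs'
        · exact Or.inl hs'
        · exact Or.inr hs'
      · rcases ht with ht | ht <;> rw [ht] at ht'
        · exact Or.inl ht'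
        · exact Or.inr ht'
  -- (3) `P(S ↔ b) ≤ P_{w₁}(o ↔ b)`
  have h3 : (prodBernoulli w).real Sb ≤
      (prodBernoulli (Function.update w s(o, y) 1)).real (openConn o b) := by
    rw [goodStep_real_update_one w hoy]
    refine measureReal_mono ?_ (measure_ne_top _ _)
    intro ω hω
    rw [Set.mem_setOf_eq, starGlueRelay_union_pair_mem_openConn_iff hoy]
    rcases hω with h | h
    · exact Or.inl h
    · exact Or.inr ⟨⟨o, hoB, SimpleGraph.Reachable.refl o⟩, ⟨y, hyB, h⟩⟩
  -- (4) `1 − P(E₁) = P(E₁ᶜ)`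
  have hE : 1 - (prodBernoulli w).real E₁ = (prodBernoulli w).real E₁ᶜ :=
    (probReal_compl_eq_one_sub MeasurableSet.of_discrete).symm
  -- (5) `{S ↔ A} ⊆ {S ↔ b} ∪ LF ∪ T₁`
  have hSA : (prodBernoulli w).real SA ≤
      (prodBernoulli w).real Sb + (prodBernoulli w).real LF + (prodBernoulli w).real T₁ := by
    calc (prodBernoulli w).real SA ≤ (prodBernoulli w).real ((Sb ∪ LF) ∪ T₁) := by
          refine measureReal_mono ?_ (measure_ne_top _ _)
          intro ω hω
          by_cases hSb : (openGraph ω).Reachable o b ∨ (openGraph ω).Reachable y b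
          · exact Or.inl (Or.inl hSb)
          · by_cases hab : (openGraph ω).Reachable a₀ b
            · exact Or.inl (Or.inr ⟨hab, hSb, hω⟩)
            · exact Or.inr ⟨hω, hSb, hab⟩
      _ ≤ (prodBernoulli w).real (Sb ∪ LF) + (prodBernoulli w).real T₁ := measureReal_union_le _ _
      _ ≤ (prodBernoulli w).real Sb + (prodBernoulli w).real LF + (prodBernoulli w).real T₁ := by
          linarith [measureReal_union_le (μ := prodBernoulli w) Sb LF]
  -- (6) `WIN ⊔ DC ⊔ T₁ ⊆ E₁ᶜ`
  have hd1 : Disjoint WIN DC :=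
    Set.disjoint_left.2 fun ω ⟨hSb, _, _⟩ ⟨_, hdead⟩ => hdead b hb hSb
  have hd2 : Disjoint (WIN ∪ DC) T₁ := by
    refine Set.disjoint_left.2 fun ω h ⟨hSA', hSb, _⟩ => ?_
    rcases h with ⟨hSb', -, -⟩ | ⟨-, hdead⟩
    · exact hSb hSb'
    · obtain ⟨a, ha, hSa⟩ := hSA'
      exact hdead a ha hSa
  have hEc : (prodBernoulli w).real WIN + (prodBernoulli w).real DC + (prodBernoulli w).real T₁ ≤
      (prodBernoulli w).real E₁ᶜ := by
    rw [← measureReal_union hd1 MeasurableSet.of_discrete,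
      ← measureReal_union hd2 MeasurableSet.of_discrete]
    refine measureReal_mono ?_ (measure_ne_top _ _)
    rintro ω ((⟨hSb, hao, hay⟩ | ⟨hab, hdead⟩) | ⟨-, hSb, hab⟩) <;> rw [Set.mem_compl_iff] <;>
      intro hE1
    · rcases hE1 with hab | ⟨hS, -⟩
      · rcases hSb with h | h
        · exact hao (hab.trans h.symm)
        · exact hay (hab.trans h.symm)
      · rcases hS with h | h
        · exact hao h
        · exact hay h
    · rcases hE1 with hab' | ⟨-, hSb⟩
      · exact hab hab'
      · exact hdead b hb hSb
    · rcases hE1 with hab' | ⟨-, hSb'⟩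
      · exact hab hab'
      · exact hSb hSb'
  -- (7) the block inequality `P(LF) ≤ P(WIN) + P(DC)`
  have hstar : (prodBernoulli w).real LF ≤ (prodBernoulli w).real WIN + (prodBernoulli w).real DC := by
    by_cases hab : a₀ = b
    · -- degenerate case `a₀ = b`: every relay is a.s. joined to `b`, so `P(LF) = 0`
      have h1' : (prodBernoulli w).real (openConn a₀ b) = 1 := by
        have huniv : (openConn a₀ b : Set (BondConfig (Fin n))) = Set.univ := by
          refine Set.eq_univ_of_forall fun ω => ?_
          rw [hab]
          exact SimpleGraph.Reachable.refl b
        rw [huniv]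
        exact probReal_univ
      have hnull : ∀ a ∈ A, (prodBernoulli w).real (openConn a b : Set (BondConfig (Fin n)))ᶜ ≤ 0 := by
        intro a ha
        rw [probReal_compl_eq_one_sub MeasurableSet.of_discrete]
        linarith [hmin a ha]
      have hLF : (prodBernoulli w).real LF ≤ 0 :=
        calc (prodBernoulli w).real LF
            ≤ (prodBernoulli w).real (⋃ a ∈ A, (openConn a b : Set (BondConfig (Fin n)))ᶜ) := by
              refine measureReal_mono ?_ (measure_ne_top _ _)
              rintro ω ⟨-, hSb, a, ha, hSa⟩
              rw [Set.mem_iUnion₂]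
              refine ⟨a, ha, ?_⟩
              rw [Set.mem_compl_iff]
              intro hconn
              rcases hSa with h | h
              · exact hSb (Or.inl (h.trans hconn))
              · exact hSb (Or.inr (h.trans hconn))
          _ ≤ ∑ a ∈ A, (prodBernoulli w).real (openConn a b : Set (BondConfig (Fin n)))ᶜ :=
              measureReal_biUnion_finset_le _ _
          _ ≤ 0 := Finset.sum_nonpos hnull
      linarith [measureReal_nonneg (μ := prodBernoulli w) (s := WIN),
        measureReal_nonneg (μ := prodBernoulli w) (s := DC)]
    · -- `a₀ ≠ b`: `A ⊆ {b, a₀, c}` for some relay `c ∈ A`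
      have ha₀' : a₀ ∈ A.erase b := Finset.mem_erase.2 ⟨hab, ha₀⟩
      have hcard' : ((A.erase b).erase a₀).card ≤ 1 := by
        rw [Finset.card_erase_of_mem ha₀']
        omega
      obtain ⟨c, hc, hA⟩ : ∃ c ∈ A, ∀ a ∈ A, a = b ∨ a = a₀ ∨ a = c := by
        rcases ((A.erase b).erase a₀).eq_empty_or_nonempty with h0 | ⟨c, hc⟩
        · refine ⟨a₀, ha₀, fun a ha => ?_⟩
          by_contra hne
          push Not at hne
          have ha' : a ∈ (A.erase b).erase a₀ :=
            Finset.mem_erase.2 ⟨hne.2.1, Finset.mem_erase.2 ⟨hne.1, ha⟩⟩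
          rw [h0] at ha'
          simp at ha'
        · refine ⟨c, (Finset.mem_erase.1 (Finset.mem_erase.1 hc).2).2, fun a ha => ?_⟩
          by_contra hne
          push Not at hne
          have ha' : a ∈ (A.erase b).erase a₀ :=
            Finset.mem_erase.2 ⟨hne.2.1, Finset.mem_erase.2 ⟨hne.1, ha⟩⟩
          exact hne.2.2 (Finset.card_le_one.1 hcard' a ha' c hc)
      exact starGlueSmall_block w A o y b a₀ c ha₀ hA (hmin c hc)
  -- (8) assemble
  linarith [h1, h2, h3, hE, hSA, hEc, hstar]

end

end Summit.CriticalPhenomena.PercolationContinuityZ3.Theorems
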